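import Mathlib
import HarnessLib

/-!
# Route `KLProgramme` — engine support, route (L2): the canonical rate solving a Leibniz inequality `Q ≤ A₀·(4/(sP))²`

Cell `gate-hubbard-kl`, seat hubbard-kl-k3c2-p3; gen-4 ENGINE child stmt-HubbardSuperconductivity-19855 (`stub_engine_step_norms`, `α_n`).  The
five hypotheses `hr₀ … hr₃` of `slicePair_charSum_l1_le` / `slicePair_bgmFat_le` / `rowSum_sliceCT_bgmFat_le` have the shape
`Q_w ≤ A₀·(4/(s_w·P_w))²` with `Q_w, A₀ > 0` explicit and the rate `s_w > 0` free.  The canonical choice `s_w := 4/(P_w·√(Q_w/A₀))` turns each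
into an EQUALITY; `1/s_w = P_w·√(Q_w/A₀)/4` is what enters the weight sum.  Pure real algebra; no definitions. [folklore]
-/

noncomputable section

namespace Summit.HubbardSuperconductivity.HubbardSuperconductivity.Theorems.TorusFourierL2

set_option linter.dupNamespace false -- summit = problem name (single-conjunct summit), D-0017

/-- **The canonical rate**: for `Q, A₀, P > 0` and `s = 4/(P·√(Q/A₀))`: `0 < s`, `Q ≤ A₀·(4/(sP))²` (indeed `=`), and `1/s = P·√(Q/A₀)/4`.
[folklore] -/
theorem sliceRate_solves {Q A₀ P : ℝ} (hQ : 0 < Q) (hA₀ : 0 < A₀) (hP : 0 < P) :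
    0 < 4 / (P * Real.sqrt (Q / A₀)) ∧ Q ≤ A₀ * (4 / (4 / (P * Real.sqrt (Q / A₀)) * P)) ^ 2 ∧
      1 / (4 / (P * Real.sqrt (Q / A₀))) = P * Real.sqrt (Q / A₀) / 4 := by
  have hr : 0 < Real.sqrt (Q / A₀) := Real.sqrt_pos.2 (div_pos hQ hA₀)
  have hsq : Real.sqrt (Q / A₀) ^ 2 = Q / A₀ := Real.sq_sqrt (div_pos hQ hA₀).le
  refine ⟨by positivity, le_of_eq ?_, ?_⟩
  · have e : 4 / (4 / (P * Real.sqrt (Q / A₀)) * P) = Real.sqrt (Q / A₀) := by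
      field_simp
    rw [e, hsq]; field_simp
  · field_simp

/-- Monotone use: if `Q′ ≤ Q` then the canonical rate for `Q` also solves the inequality for `Q′`. [folklore] -/
theorem sliceRate_solves_of_le {Q Q' A₀ P : ℝ} (hQ : 0 < Q) (hA₀ : 0 < A₀) (hP : 0 < P) (hQ' : Q' ≤ Q) :
    Q' ≤ A₀ * (4 / (4 / (P * Real.sqrt (Q / A₀)) * P)) ^ 2 :=
  hQ'.trans (sliceRate_solves hQ hA₀ hP).2.1

end Summit.HubbardSuperconductivity.HubbardSuperconductivity.Theorems.TorusFourierL2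

end
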